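/-
Copyright (c) 2026 the pub-hodgecm-mathlib formalisation cell (harness21).  Prover seat hodgecm-mathlib-K2Liu-p05 (g3), 2026-09-04
(Track B «K2-LIT», crux hLiu418 = stmt-HodgeConjecture-24832, socket #42F′, ROAD I v3, organ G2-Weil, sub-organ (G2-W4b) analytic half:
smoothness along `U(2,2)` survives a continuous character twist and transports through the archimedean place factorisation).
-/
import Summits.HodgeConjecture.HodgeConjecture.Theorems.K2LiuWeilDatumSmoothU22                -- (G2-W2): `contDiffAt_weilDatum_inl`, `u22X`
import Literature.RepresentationTheory.KonnoKonno2007.JunctionCharacterSmooth                 -- ★ É. Cartan for characters + `contDiffAt_smul_of_forall`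
import Literature.NumberTheory.Weil1964.ArchWeilDatumFactorisationTransport                   -- ★ `tensorPi`, `sumProdLeftCLM_apply_eq_tensorPi`, the factorisation
import HarnessLib

/-!
# (G2-W4b, analytic half) Smoothness along `U(2,2)` under a continuous character twist, and its TRANSPORT through the archimedean
# one-place factorisation `Ω (s u) (Φ₁ ⊠ Φ₂) = ((χ ⊗ ω₁) u Φ₁) ⊠ Φ₂`

Track B ∕ K2-LIT, hLiu418 = stmt-HodgeConjecture-24832, #42F′ ROAD I v3 organ G2-Weil, bridge (G2-W4) «`doubledWeilRep` at a real place» (K2E5-plan (g5)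
07:09:19Z cut, LEAD F0P6-plan (g12) 07:09:36Z): THE `U(2,2)` TWIN of ★ `KonnoKonno2007.JunctionCharacterSmooth` + the generic transport step of ★
`HodgeCM/Model/HypCensus/SmoothBlock`.  Namespace `Summit.HodgeConjecture.HodgeConjecture.Cruxes.HLiu418.K2LiuWeilDatumSmoothU22` (continued).
THEOREMS ONLY (no definition, no instance, no notation, no named fact, no `sorry`); the Mathlib idiom `attribute [local instance 100]
LieRing.ofAssociativeRing` as in (G2-W2); `--supports stmt-HodgeConjecture-24832 --as helper`.

WHY.  The archimedean factorisation ★ `IsArchWeilDatum.exists_circle_twist_factorisation` reads a BIG archimedean Weil datum `Ω` (all real places; for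
#42F′: the archimedean operator of `doubledWeilRep χ` — ★ `doubledWeilRep_archToAdelic_eq_archHalfOf`, ★ `omega_archHalfOf_tmul` — Folland's section of
the doubled group `⊗ η_t`) along the one-place section `s` of `U(2,2) × U(R,S)` as `Ω (s u) (Φ₁ ⊠ Φ₂) = ((χ ⊗ ω₁) u Φ₁) ⊠ Φ₂` for a SMALL junction datum `ω₁`
TWISTED by a continuous circle character `χ`.  (G2-W2) differentiates `ω₁` (vacuum clause `vacScalar e`); the twisted datum `χ ⊗ ω₁` has vacuum character
`χ ∘ κ · vacScalar e`, NOT of the form `vacScalar e′`, so (G2-W2) does not apply to it verbatim — this file closes that gap exactly as ★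
`JunctionCharacterSmooth` does for `U(2,1)`, and then pushes the result through the product map `· ⊠ Φ₂` (a continuous linear map, ★ `sumProdLeftCLM`).

* §1 **`contDiffAt_character_inl`** — a CONTINUOUS character `χ : U(2,2) × U(R,S) →* ℂ` is `C^∞` along `U(2,2)` (★
  `RealMatrixGroup.contDiffAt_character_of_continuous` at ★ `u22AdaptedBasis`; [Varadarajan1984, Thm. 2.11.2]);
* §2 **`contDiffAt_charTwist_inl`** — (G2-W2)'s `contDiffAt_weilDatum_inl` for the twisted datum `charTwist χ ω` (★ `contDiffAt_smul_of_forall`);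
* §3 **`contDiffAt_of_tensorPi_factorisation`** — TRANSPORT: if `Ω (s u) (Φ₁ ⊠ Φ₂) = (charTwist (χ) ω₁ u Φ₁) ⊠ Φ₂` for all `u`, `Φ₁` (the output of ★
  `exists_circle_twist_factorisation`, `χ` continuous, `ω₁` a junction datum of `U(2,2) × U(R,S)` with vacuum clause), then for every matrix-smooth
  `c : B → U(2,2)`, every continuous ℝ-linear `T` on the BIG Schwartz space and every `Φ₁`, `x ↦ T (Ω (s (c x, 1)) (Φ₁ ⊠ Φ₂))` is `C^∞` — the analytic half of
  the bridge; the remaining half of (G2-W4b) is to PRODUCE the five inputs `hW hc s hs_cont hs` of the factorisation for the doubled datum at a real place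
  (twin of ★ `HypCensus/ArchDatumBlockAt` over ★ `DoubledWeilRepresentationArchPlace*`), which is frame bookkeeping, not analysis.

HONEST LABEL: HC_CM is proved only modulo the 7 printed citations (2 remaining named inputs: hLiu418 = stmt-HodgeConjecture-24832, h413 =
stmt-HodgeConjecture-24833) until rung 0 closes; organ capital for #42F′'s Road I, moves no counter.

## References
* [Varadarajan1984] V. S. Varadarajan, *Lie Groups, Lie Algebras, and Their Representations* (1984), Thm. 2.10.1, (2.10.19), Thm. 2.11.2.
* [Folland1989] G. B. Folland, *Harmonic Analysis in Phase Space* (1989), Prop. (1.43), §4.2 (4.23)–(4.24), Prop. (4.39).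
-/

set_option autoImplicit false
set_option linter.dupNamespace false

noncomputable section

open scoped MatrixGroups Matrix Topology SchwartzMap Matrix.Norms.Operator
open Filter
open Literature.NumberTheory.Automorphic Literature.Analysis.SegalBargmann Literature.NumberTheory.Weil1964
open Literature.Analysis.Distribution
open Literature.RepresentationTheory.KonnoKonno2007 hiding LetterKind letterOf letterGen letterOf_boost letterOf_torus letterOf_torus_eq
  letterGen_boost letterGen_torus letterGen_mem_lie exp_smul_letterGen
open Literature.RepresentationTheory.KonnoKonno2007.RealDualPair
open Literature.RepresentationTheory.KonnoKonno2007.RealDualPair.UForm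
open Summit.HodgeConjecture.HodgeConjecture.Cruxes.HLiu418.K2LiuU22AdaptedBasis

-- Mathlib idiom (`Mathlib/Algebra/Lie/OfAssociative.lean`), as in ★ `RealMatrixGroups` ∕ ★ `JunctionArchDifferentiable`: the commutator bracket on
-- `Matrix n n ℂ`, needed to name the Lie subalgebra `(uFormGroup (Fin 2) (Fin 2)).lie`
attribute [local instance 100] LieRing.ofAssociativeRing

namespace Summit.HodgeConjecture.HodgeConjecture.Cruxes.HLiu418.K2LiuWeilDatumSmoothU22

variable {R S : Type*} [Fintype R] [DecidableEq R] [Fintype S] [DecidableEq S]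
  {V : Type*} [NormedAddCommGroup V] [NormedSpace ℝ V]

/-! ## §1 A continuous character is smooth along `U(2,2)` -/

set_option backward.isDefEq.respectTransparency false in
/-- **A continuous character of `U(2,2) × U(R,S)` is `C^∞` along `U(2,2)`**: for `c : B → U(2,2)` smooth at `x₀` as a matrix-valued map, `x ↦ χ (c x, 1)` is
`C^∞` at `x₀` (É. Cartan for characters: ★ `RealMatrixGroup.contDiffAt_character_of_continuous` at the adapted basis ★ `u22AdaptedBasis` of `𝔲(2,2)`).
[cite: Varadarajan1984, Thm. 2.11.2, p. 138] -/
theorem contDiffAt_character_inl {χ : Ginf (Fin 2) (Fin 2) R S →* ℂ} (hχ : Continuous χ)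
    {B : Type*} [NormedAddCommGroup B] [NormedSpace ℝ B] {c : B → UForm (Fin 2) (Fin 2)} {x₀ : B}
    (hc : ContDiffAt ℝ ((⊤ : ℕ∞) : WithTop ℕ∞) (fun x => ((c x : GL (Fin 2 ⊕ Fin 2) ℂ) : Matrix (Fin 2 ⊕ Fin 2) (Fin 2 ⊕ Fin 2) ℂ)) x₀) :
    ContDiffAt ℝ ((⊤ : ℕ∞) : WithTop ℕ∞) (fun x => χ ((c x, (1 : UForm R S)) : Ginf (Fin 2) (Fin 2) R S)) x₀ :=
  (uFormGroup (Fin 2) (Fin 2)).contDiffAt_character_of_continuous uFormGroup_regular u22X u22AdaptedBasis coe_u22X_eq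
    (χ := χ.comp (MonoidHom.inl (UForm (Fin 2) (Fin 2)) (UForm R S))) (hχ.comp (continuous_id.prodMk continuous_const)) hc

/-! ## §2 (G2-W2) for the twisted datum `charTwist χ ω` -/

set_option backward.isDefEq.respectTransparency false in
/-- **(G2-W2) under a character twist, `inl` form.**  For an archimedean Weil datum `ω` of `U(2,2) × U(R,S)` with vacuum clause and a continuous character
`χ` of `G_∞`, every `x ↦ T (charTwist χ ω (c x, 1) Φ)` is `C^∞` at `x₀` (`c` smooth at `x₀` into `U(2,2)`, `T` continuous real-linear).
[cite: Varadarajan1984, Thm. 2.10.1 and (2.10.19), p. 89] -/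
theorem contDiffAt_charTwist_inl {ω : Representation ℂ (Ginf (Fin 2) (Fin 2) R S) (SchwartzMap (DPIdx (Fin 2) (Fin 2) R S → ℝ) ℂ)}
    (hW : IsArchWeilDatum (ι𝕎 (Fin 2) (Fin 2) R S) ω) {e : VacExponents}
    (hvac : ∀ k : DPK (Fin 2) (Fin 2) R S, ω (κ (Fin 2) (Fin 2) R S k) (hermitePi 0) = vacScalar e k • hermitePi 0)
    {χ : Ginf (Fin 2) (Fin 2) R S →* ℂ} (hχ : Continuous χ)
    {B : Type*} [NormedAddCommGroup B] [NormedSpace ℝ B] {c : B → UForm (Fin 2) (Fin 2)} {x₀ : B}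
    (hc : ContDiffAt ℝ ((⊤ : ℕ∞) : WithTop ℕ∞) (fun x => ((c x : GL (Fin 2 ⊕ Fin 2) ℂ) : Matrix (Fin 2 ⊕ Fin 2) (Fin 2 ⊕ Fin 2) ℂ)) x₀)
    (T : (SchwartzMap (DPIdx (Fin 2) (Fin 2) R S → ℝ) ℂ) →L[ℝ] V) (Φ : SchwartzMap (DPIdx (Fin 2) (Fin 2) R S → ℝ) ℂ) :
    ContDiffAt ℝ ((⊤ : ℕ∞) : WithTop ℕ∞) (fun x => T (charTwist χ ω ((c x, (1 : UForm R S)) : Ginf (Fin 2) (Fin 2) R S) Φ)) x₀ := by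
  simp only [charTwist_apply]
  exact contDiffAt_smul_of_forall (contDiffAt_character_inl hχ hc) (fun T' => contDiffAt_weilDatum_inl hW hvac hc T' Φ) T

/-- **… with a CIRCLE character** (the shape produced by ★ `IsArchWeilDatum.exists_circle_twist_factorisation`: `charTwist (Circle.coeHom.comp χ) ω`).
[cite: Varadarajan1984, Thm. 2.10.1 and (2.10.19), p. 89] -/
theorem contDiffAt_charTwist_circle_inl {ω : Representation ℂ (Ginf (Fin 2) (Fin 2) R S) (SchwartzMap (DPIdx (Fin 2) (Fin 2) R S → ℝ) ℂ)}
    (hW : IsArchWeilDatum (ι𝕎 (Fin 2) (Fin 2) R S) ω) {e : VacExponents}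
    (hvac : ∀ k : DPK (Fin 2) (Fin 2) R S, ω (κ (Fin 2) (Fin 2) R S k) (hermitePi 0) = vacScalar e k • hermitePi 0)
    {χ : Ginf (Fin 2) (Fin 2) R S →* Circle} (hχ : Continuous χ)
    {B : Type*} [NormedAddCommGroup B] [NormedSpace ℝ B] {c : B → UForm (Fin 2) (Fin 2)} {x₀ : B}
    (hc : ContDiffAt ℝ ((⊤ : ℕ∞) : WithTop ℕ∞) (fun x => ((c x : GL (Fin 2 ⊕ Fin 2) ℂ) : Matrix (Fin 2 ⊕ Fin 2) (Fin 2 ⊕ Fin 2) ℂ)) x₀)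
    (T : (SchwartzMap (DPIdx (Fin 2) (Fin 2) R S → ℝ) ℂ) →L[ℝ] V) (Φ : SchwartzMap (DPIdx (Fin 2) (Fin 2) R S → ℝ) ℂ) :
    ContDiffAt ℝ ((⊤ : ℕ∞) : WithTop ℕ∞)
      (fun x => T (charTwist (Circle.coeHom.comp χ) ω ((c x, (1 : UForm R S)) : Ginf (Fin 2) (Fin 2) R S) Φ)) x₀ :=
  contDiffAt_charTwist_inl hW hvac (χ := Circle.coeHom.comp χ) (continuous_subtype_val.comp hχ) hc T Φ

/-! ## §3 Transport through the one-place factorisation `Ω (s u) (Φ₁ ⊠ Φ₂) = ((χ ⊗ ω₁) u Φ₁) ⊠ Φ₂` -/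

/-- **THE ANALYTIC HALF OF THE BRIDGE (G2-W4b).**  Let `Ω` be a representation of a group `G` on the BIG Schwartz space `𝓢(ℝ^{DPIdx ⊕ σ₂})` (all real places),
`s : U(2,2) × U(R,S) →* G` a one-place section, and suppose the archimedean factorisation holds at the product vectors:
`Ω (s u) (Φ₁ ⊠ Φ₂) = (charTwist (χ) ω₁ u Φ₁) ⊠ Φ₂` with `χ` a continuous circle character and `ω₁` an archimedean Weil datum of `U(2,2) × U(R,S)` with vacuum
clause (the conclusion of ★ `IsArchWeilDatum.exists_circle_twist_factorisation`).  Then for every `c : B → U(2,2)` smooth at `x₀` as a matrix-valued map, every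
continuous ℝ-linear `T` on the big space and every `Φ₁`, `x ↦ T (Ω (s (c x, 1)) (Φ₁ ⊠ Φ₂))` is `C^∞` at `x₀` — §2 composed with the continuous linear product map
`· ⊠ Φ₂` (★ `SchwartzMap.sumProdLeftCLM`, ★ `sumProdLeftCLM_apply_eq_tensorPi`). [cite: Folland1989, Prop. (1.43), §4.2 (4.23)]
[cite: Varadarajan1984, Thm. 2.10.1 and (2.10.19), p. 89] -/
theorem contDiffAt_of_tensorPi_factorisation {σ₂ : Type*} [Fintype σ₂] {G : Type*} [Group G]
    (Ω : Representation ℂ G (SchwartzMap (DPIdx (Fin 2) (Fin 2) R S ⊕ σ₂ → ℝ) ℂ)) (s : Ginf (Fin 2) (Fin 2) R S →* G)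
    {ω₁ : Representation ℂ (Ginf (Fin 2) (Fin 2) R S) (SchwartzMap (DPIdx (Fin 2) (Fin 2) R S → ℝ) ℂ)}
    (hW₁ : IsArchWeilDatum (ι𝕎 (Fin 2) (Fin 2) R S) ω₁) {e : VacExponents}
    (hvac₁ : ∀ k : DPK (Fin 2) (Fin 2) R S, ω₁ (κ (Fin 2) (Fin 2) R S k) (hermitePi 0) = vacScalar e k • hermitePi 0)
    {χ : Ginf (Fin 2) (Fin 2) R S →* Circle} (hχ : Continuous χ) (Φ₂ : SchwartzMap (σ₂ → ℝ) ℂ)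
    (hfac : ∀ (u : Ginf (Fin 2) (Fin 2) R S) (Φ₁ : SchwartzMap (DPIdx (Fin 2) (Fin 2) R S → ℝ) ℂ),
      Ω (s u) (tensorPi Φ₁ Φ₂) = tensorPi (charTwist (Circle.coeHom.comp χ) ω₁ u Φ₁) Φ₂)
    {B : Type*} [NormedAddCommGroup B] [NormedSpace ℝ B] {c : B → UForm (Fin 2) (Fin 2)} {x₀ : B}
    (hc : ContDiffAt ℝ ((⊤ : ℕ∞) : WithTop ℕ∞) (fun x => ((c x : GL (Fin 2 ⊕ Fin 2) ℂ) : Matrix (Fin 2 ⊕ Fin 2) (Fin 2 ⊕ Fin 2) ℂ)) x₀)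
    (T : (SchwartzMap (DPIdx (Fin 2) (Fin 2) R S ⊕ σ₂ → ℝ) ℂ) →L[ℝ] V) (Φ₁ : SchwartzMap (DPIdx (Fin 2) (Fin 2) R S → ℝ) ℂ) :
    ContDiffAt ℝ ((⊤ : ℕ∞) : WithTop ℕ∞) (fun x => T (Ω (s ((c x, (1 : UForm R S)) : Ginf (Fin 2) (Fin 2) R S)) (tensorPi Φ₁ Φ₂))) x₀ := by
  have hT : ∀ x, T (Ω (s ((c x, (1 : UForm R S)) : Ginf (Fin 2) (Fin 2) R S)) (tensorPi Φ₁ Φ₂)) =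
      (T.comp ((SchwartzMap.sumProdLeftCLM (𝕜 := ℂ) (E := ℝ) (ι₁ := DPIdx (Fin 2) (Fin 2) R S) Φ₂).restrictScalars ℝ))
        (charTwist (Circle.coeHom.comp χ) ω₁ ((c x, (1 : UForm R S)) : Ginf (Fin 2) (Fin 2) R S) Φ₁) := fun x => by
    rw [hfac, ContinuousLinearMap.comp_apply]
    show _ = T (SchwartzMap.sumProdLeftCLM Φ₂ _)
    rw [sumProdLeftCLM_apply_eq_tensorPi]
  simp only [hT]
  exact contDiffAt_charTwist_circle_inl hW₁ hvac₁ hχ hc _ Φ₁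

end Summit.HodgeConjecture.HodgeConjecture.Cruxes.HLiu418.K2LiuWeilDatumSmoothU22

end
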